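import Mathlib
import Summits.Ventures.PercRepro2.TypedPocketA1BSupport
import Summits.Ventures.PercRepro2.TypedPocketA1BCertB
import Summits.Ventures.PercRepro2.TypedHarrisSpectator
import Summits.Ventures.PercRepro2.TypedSepThreeTheorem
import Summits.Ventures.PercRepro2.TypedPocketABTheorem
import Summits.Ventures.PercRepro2.TypedFactor
import Summits.Ventures.PercRepro2.TypedSwapRoots

/-!
# The `{a₁, b}`-pocket class (HARRIS-1), IV: row 2′TRI on the class (blind cell PercRepro2, p3 g8,
2026-08-26; `proofs/P3-HARRIS.md` §4)

On a `{a₁, b}`-pocket split (`SplitH`: the doors `a₁, b` separate `o` from `a₂, a₃`) the kernel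
`K₃` is a side kernel (`K3_eq_sideH`), its doubly symmetrised form is `dsymH` on the side states
(`symB_symA_sideΦH`), and `dsymH` is the certified combination of six-fold symmetrised
typed-Harris-with-spectator slacks at the SORTED far triple plus a pointwise nonnegative remainder
(`TypedPocketA1BCertB.lean`).  The count of the combination factorises over the two sides
(`TypedFactor.typedCount_mul_of_disjoint`, the far side contributing the nonnegative weights, the
pocket side the slacks), each slack has nonnegative typed count by
`TypedHarris.typedCount_slack_nonneg` and the copy symmetry, and the remainder has nonnegative count
pointwise: with `36 · typedCount (sideKernel Φ) = typedCount (sideKernel (symB (symA Φ)))`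
**every typed base of `K₃` is nonnegative**: `typedCount_nonneg_of_splitH`, the `z ≡ false`
class `HasPocketA1B`, `typedCount_nonneg_of_hasPocketA1B` and the root mirror
`typedCount_nonneg_of_hasPocketA1B_mirror` (the doors `a₂, b`).  A NEW MECHANISM for row 2′TRI:
not a pointwise kernel, but Harris inequalities on one side of a separator conditioned on the
other side's states.  Own work; standard axioms.
-/

namespace Summit.Ventures.PercRepro2

open UnionCluster

namespace CovForm

namespace PocketA1B

open OneTyped TypedA3 Untouched TypedFactor Separated RootBridge SepThree

/-! ## The certified combination as a sum over generator labels -/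

section Gensum

/-- A generator label: the spectator condition and the two events. -/
abbrev GenLabel := Option OSt × Fin 4 × Fin 4

/-- The label of a certificate term. -/
def labelOf (c : CertH) : GenLabel := (c.1, c.2.1, c.2.2.1)

/-- The total weight of a generator label at a far triple. -/
def weightH (g : GenLabel) (u v r : BSt) : ℕ :=
  (((certH u v r).filter fun c => labelOf c = g).map fun c => c.2.2.2).sum

/-- A weighted list-sum over certificate terms, regrouped by label. -/
lemma listSum_eq_gensum (L : List CertH) (f : GenLabel → ℤ) :
    (L.map fun c => (c.2.2.2 : ℤ) * f (labelOf c)).sum =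
      ∑ g : GenLabel, ((((L.filter fun c => labelOf c = g).map fun c => c.2.2.2).sum : ℕ) : ℤ) *
        f g := by
  induction L with
  | nil => simp
  | cons c L ih =>
    rw [List.map_cons, List.sum_cons, ih]
    have hsplit : ∀ g : GenLabel,
        ((((List.filter (fun c => decide (labelOf c = g)) (c :: L)).map fun c => c.2.2.2).sum : ℕ)
            : ℤ) * f g =
          (if labelOf c = g then (c.2.2.2 : ℤ) * f g else 0) +
            ((((L.filter fun c => labelOf c = g).map fun c => c.2.2.2).sum : ℕ) : ℤ) * f g := by
      intro g
      by_cases hg : labelOf c = g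
      · simp [hg, add_mul]
      · simp [hg]
    simp only [hsplit, Finset.sum_add_distrib, Finset.sum_ite_eq, Finset.mem_univ, if_true]

/-- **The certified combination is a sum over generator labels** with nonnegative integer
weights. -/
lemma combH_eq_gensum (x y w : OSt) (u v r : BSt) :
    combH x y w u v r =
      ∑ g : GenLabel, (weightH g u v r : ℤ) * genH g.1 g.2.1 g.2.2 x y w := by
  unfold combH weightH
  exact listSum_eq_gensum (certH u v r) (fun g => genH g.1 g.2.1 g.2.2 x y w)

end Gensum

/-! ## Linear algebra of typed counts -/

section Linear

variable {E : Type*} [Fintype E] [DecidableEq E] {R : Type*} [Field R]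

/-- The typed count of a finite sum of kernels. -/
lemma typedCount_finsum {ι : Type*} (s : Finset ι) (F : Finset E) (z : Config E) (τ : E → ℕ)
    (K : ι → Config E → Config E → Config E → R) :
    typedCount F z τ (fun x y w => ∑ i ∈ s, K i x y w) = ∑ i ∈ s, typedCount F z τ (K i) := by
  classical
  induction s using Finset.induction_on with
  | empty =>
    simp only [Finset.sum_empty]
    exact typedCount_zero_kernel F z τ
  | insert a s ha ih =>
    simp only [Finset.sum_insert ha]
    rw [typedCount_add', ih]

end Linear

/-! ## The side kernel and its decomposition -/

section Main

open Classical

variable {V : Type*} {E : Type*} [Fintype E] [DecidableEq E] {R : Type*} [Field R]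
  [LinearOrder R] [IsStrictOrderedRing R]
variable (ends : E → Sym2 V) (o a₁ a₂ a₃ b : V)

/-- The kernel on the side restrictions: `KB` on the glued side states. -/
noncomputable def sideΦH (WO WB : Set V) :
    Config E → Config E → Config E → Config E → Config E → Config E → R :=
  fun xa ya wa xb yb wb =>
    ((KB (gluedH (PocketAB.oStP ends o a₁ b WO xa) (bSt ends a₁ a₂ a₃ b WB xb))
      (gluedH (PocketAB.oStP ends o a₁ b WO ya) (bSt ends a₁ a₂ a₃ b WB yb))
      (gluedH (PocketAB.oStP ends o a₁ b WO wa) (bSt ends a₁ a₂ a₃ b WB wb)) : ℤ) : R)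

/-- The sorted far triple of three configurations. -/
noncomputable def sortedB (WB : Set V) (xb yb wb : Config E) : BSt × BSt × BSt :=
  sort3B (bSt ends a₁ a₂ a₃ b WB xb) (bSt ends a₁ a₂ a₃ b WB yb) (bSt ends a₁ a₂ a₃ b WB wb)

/-- The certified part of the side kernel: the combination of slacks at the sorted far triple. -/
noncomputable def certΦ (WO WB : Set V) :
    Config E → Config E → Config E → Config E → Config E → Config E → R :=
  fun xa ya wa xb yb wb =>
    ((combH (PocketAB.oStP ends o a₁ b WO xa) (PocketAB.oStP ends o a₁ b WO ya)
      (PocketAB.oStP ends o a₁ b WO wa) (sortedB ends a₁ a₂ a₃ b WB xb yb wb).1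
      (sortedB ends a₁ a₂ a₃ b WB xb yb wb).2.1 (sortedB ends a₁ a₂ a₃ b WB xb yb wb).2.2 : ℤ) : R)

variable {ends o a₁ a₂ a₃ b}

omit [Fintype E] [LinearOrder R] [IsStrictOrderedRing R] in
/-- **`K₃` on the support of a `{a₁, b}`-pocket split is a side kernel.** -/
theorem K3_eq_sideH {WO WB : Set V} {F : Finset E} {z : Config E}
    (h : SplitH ends o a₁ a₂ a₃ b WO WB F z) {x y w : Config E}
    (hx : ∀ e, e ∉ F → x e = z e) (hy : ∀ e, e ∉ F → y e = z e) (hw : ∀ e, e ∉ F → w e = z e) :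
    (K3 ends o a₁ a₂ a₃ b x y w : R) =
      sideKernel (sideF ends WO F) (sideF ends WB F) z (sideΦH ends o a₁ a₂ a₃ b WO WB) x y w := by
  rw [K3_eq_KB, st_eq_harrisSt h (le_zF hx), st_eq_harrisSt h (le_zF hy),
    st_eq_harrisSt h (le_zF hw)]
  unfold sideKernel sideΦH
  rw [PocketAB.oStP_restr (a₃ := a₁) WO hx, PocketAB.oStP_restr (a₃ := a₁) WO hy,
    PocketAB.oStP_restr (a₃ := a₁) WO hw, bSt_restr WB hx, bSt_restr WB hy, bSt_restr WB hw]

omit [Fintype E] [DecidableEq E] [LinearOrder R] [IsStrictOrderedRing R] in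
/-- The doubly symmetrised side kernel is `dsymH` on the side states. -/
lemma symB_symA_sideΦH (WO WB : Set V) (xa ya wa xb yb wb : Config E) :
    symB (symA (sideΦH ends o a₁ a₂ a₃ b WO WB)) xa ya wa xb yb wb =
      ((dsymH (PocketAB.oStP ends o a₁ b WO xa) (PocketAB.oStP ends o a₁ b WO ya)
        (PocketAB.oStP ends o a₁ b WO wa) (bSt ends a₁ a₂ a₃ b WB xb) (bSt ends a₁ a₂ a₃ b WB yb)
        (bSt ends a₁ a₂ a₃ b WB wb) : ℤ) : R) := by
  unfold symB symA sideΦH dsymH psiH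
  push_cast
  ring

omit [Fintype E] [DecidableEq E] in
/-- **The doubly symmetrised side kernel dominates its certified part.** -/
lemma certΦ_le_symB_symA (WO WB : Set V) (xa ya wa xb yb wb : Config E) :
    certΦ ends o a₁ a₂ a₃ b WO WB xa ya wa xb yb wb ≤
      symB (symA (sideΦH (R := R) ends o a₁ a₂ a₃ b WO WB)) xa ya wa xb yb wb := by
  rw [symB_symA_sideΦH]
  unfold certΦ
  have hsort := dsymH_sort3B (PocketAB.oStP ends o a₁ b WO xa) (PocketAB.oStP ends o a₁ b WO ya)
    (PocketAB.oStP ends o a₁ b WO wa) (bSt ends a₁ a₂ a₃ b WB xb) (bSt ends a₁ a₂ a₃ b WB yb)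
    (bSt ends a₁ a₂ a₃ b WB wb)
  rw [hsort]
  exact_mod_cast dsymH_ge_combH_sorted _ _ _ _ _ _ (PocketAB.validO_oStP WO xa)
    (PocketAB.validO_oStP WO ya) (PocketAB.validO_oStP WO wa)
    (sort3B_mem _ _ _ (validB_bSt WB xb) (validB_bSt WB yb) (validB_bSt WB wb))

/-! ## The slacks on the pocket side -/

omit [Fintype E] [DecidableEq E] in
/-- The pocket-side state map is monotone. -/
lemma oStP_monotone (WO : Set V) : Monotone (PocketAB.oStP ends o a₁ b WO : Config E → OSt) := by
  intro x y hxy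
  have hres : withinRestr ends WO x ≤ withinRestr ends WO y := by
    intro e
    unfold withinRestr
    split_ifs
    · exact hxy e
    · exact le_rfl
  have key : ∀ p q : V, decide (Conn ends (withinRestr ends WO x) p q) ≤
      decide (Conn ends (withinRestr ends WO y) p q) := by
    intro p q
    by_cases hc : Conn ends (withinRestr ends WO x) p q
    · simp [hc, conn_mono hres hc]
    · simp [hc]
  exact ⟨key _ _, key _ _, key _ _⟩

/-- The four events are monotone. -/
lemma upH_mono (i : Fin 4) (s s' : OSt) (hs : s ≤ s') (h : upH i s = true) :
    upH i s' = true := by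
  obtain ⟨h1, h2, h3⟩ := hs
  have e1 : s.1 = true → s'.1 = true := fun hh => by rw [hh] at h1; exact Bool.eq_true_of_true_le h1
  have e2 : s.2.1 = true → s'.2.1 = true := fun hh => by
    rw [hh] at h2; exact Bool.eq_true_of_true_le h2
  have e3 : s.2.2 = true → s'.2.2 = true := fun hh => by
    rw [hh] at h3; exact Bool.eq_true_of_true_le h3
  fin_cases i <;> simp only [upH, Bool.or_eq_true] at h ⊢
  · exact e3 h
  · exact e1 h
  · exact h.elim (fun hh => Or.inl (e2 hh)) (fun hh => Or.inr (e3 hh))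
  · exact h.elim (fun hh => Or.inl (e1 hh)) (fun hh => Or.inr (e2 hh))

omit [Fintype E] [DecidableEq E] [LinearOrder R] [IsStrictOrderedRing R] in
/-- The slack kernel, cast to `R`, in the form of `typedCount_slack_nonneg`. -/
lemma slackH_cast (f : Option OSt) (a c : Fin 4) (x y w : OSt) :
    ((slackH f a c x y w : ℤ) : R) =
      ((specH f w : ℤ) : R) * ((if upH a x = true then (1 : R) else 0) *
        ((if upH c x = true then (1 : R) else 0) - (if upH c y = true then (1 : R) else 0))) := by
  unfold slackH bz
  push_cast
  rfl

/-- **Every six-fold symmetrised slack has nonnegative typed count on the pocket side.** -/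
theorem typedCount_genH_nonneg (WO : Set V) (A : Finset E) (z : Config E) (τ : E → ℕ)
    (hτ : ∀ e ∈ A, τ e = 1 ∨ τ e = 2) (g : GenLabel) :
    0 ≤ typedCount A z τ (fun x y w =>
      ((genH g.1 g.2.1 g.2.2 (PocketAB.oStP ends o a₁ b WO x) (PocketAB.oStP ends o a₁ b WO y)
        (PocketAB.oStP ends o a₁ b WO w) : ℤ) : R)) := by
  have hspec : ∀ s : OSt, (0 : R) ≤ ((specH g.1 s : ℤ) : R) := by
    intro s
    rcases g.1 with _ | t
    · simp [specH]
    · simp only [specH]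
      split_ifs <;> simp
  have hK := TypedHarris.typedCount_slack_nonneg (R := R) A z τ hτ
    (PocketAB.oStP ends o a₁ b WO) (oStP_monotone WO) (upH g.2.1) (upH g.2.2)
    (upH_mono g.2.1) (upH_mono g.2.2) (fun s => ((specH g.1 s : ℤ) : R)) hspec
  have h6 := TypedHarris.typedCount_sym6_nonneg (R := R) A z τ hτ _ hK
  refine le_of_le_of_eq h6 (typedCount_congr' _ _ _ _ _ fun x y w => ?_)
  unfold genH
  push_cast
  simp only [slackH_cast]

/-! ## The theorem -/

/-- **ROW 2′TRI ON THE `{a₁, b}`-POCKET CLASS**: on a `{a₁, b}`-pocket split — the doors `a₁, b`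
separate `o` from `a₂` and `a₃` — every typed base of `K₃` is nonnegative, for every pinning `z`
and every type map with values in `{1, 2}` on `F`. -/
theorem typedCount_nonneg_of_splitH {WO WB : Set V} (F : Finset E) (z : Config E) (τ : E → ℕ)
    (hτ : ∀ e ∈ F, τ e = 1 ∨ τ e = 2) (h : SplitH ends o a₁ a₂ a₃ b WO WB F z) :
    0 ≤ typedCount F z τ (K3 ends o a₁ a₂ a₃ b : Config E → Config E → Config E → R) := by
  set A := sideF ends WO F with hA
  set B := sideF ends WB F with hB
  have hAF : A ⊆ F := Finset.filter_subset _ _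
  have hBF : B ⊆ F := Finset.filter_subset _ _
  have hAB : Disjoint A B := by
    rw [Finset.disjoint_left]
    intro e heA heB
    simp only [hA, hB, sideF, Finset.mem_filter] at heA heB
    exact h.noloop e heA.1 ⟨heA.2, heB.2⟩
  have hF : A ∪ B = F := by
    apply Finset.Subset.antisymm (Finset.union_subset hAF hBF)
    intro e he
    have hz : zF F z e = true := by simp [zF, he]
    rcases h.split e hz with hw | hw
    · exact Finset.mem_union_left _ (Finset.mem_filter.2 ⟨he, hw⟩)
    · exact Finset.mem_union_right _ (Finset.mem_filter.2 ⟨he, hw⟩)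
  have hτA : ∀ e ∈ A, τ e = 1 ∨ τ e = 2 := fun e he => hτ e (hAF he)
  -- the count is a side kernel count
  have hker : typedCount F z τ (K3 ends o a₁ a₂ a₃ b : Config E → Config E → Config E → R) =
      typedCount F z τ (sideKernel A B z (sideΦH ends o a₁ a₂ a₃ b WO WB)) := by
    refine typedCount_congr_on_support F z τ fun x y w hc _ => ?_
    exact K3_eq_sideH h (fun e he => (hc e he).1) (fun e he => (hc e he).2.1)
      (fun e he => (hc e he).2.2)
  rw [hker]
  -- thirty-six times the count is the count of the doubly symmetrised kernel
  have h36 := thirtysix_mul_typedCount_side F hAF hBF hAB z τ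
    (sideΦH (R := R) ends o a₁ a₂ a₃ b WO WB)
  -- which splits as the certified part plus a nonnegative remainder
  set Φs := symB (symA (sideΦH (R := R) ends o a₁ a₂ a₃ b WO WB)) with hΦs
  set Φc := certΦ (R := R) ends o a₁ a₂ a₃ b WO WB with hΦc
  have hsplit : typedCount F z τ (sideKernel A B z Φs) =
      typedCount F z τ (sideKernel A B z Φc) +
        typedCount F z τ (sideKernel A B z fun xa ya wa xb yb wb =>
          Φs xa ya wa xb yb wb - Φc xa ya wa xb yb wb) := by
    rw [← typedCount_add']
    refine typedCount_congr' _ _ _ _ _ fun x y w => ?_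
    simp only [sideKernel]
    ring
  have hrem : 0 ≤ typedCount F z τ (sideKernel A B z fun xa ya wa xb yb wb =>
      Φs xa ya wa xb yb wb - Φc xa ya wa xb yb wb) := by
    refine typedCount_nonneg_of_nonneg _ _ _ fun x y w => ?_
    simp only [sideKernel]
    exact sub_nonneg.2 (certΦ_le_symB_symA WO WB _ _ _ _ _ _)
  -- the certified part factorises over the two sides, generator by generator
  have hcert : 0 ≤ typedCount F z τ (sideKernel A B z Φc) := by
    have hsum : sideKernel A B z Φc = fun x y w => ∑ g : GenLabel,
        (((genH g.1 g.2.1 g.2.2 (PocketAB.oStP ends o a₁ b WO (restr A z x))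
            (PocketAB.oStP ends o a₁ b WO (restr A z y))
            (PocketAB.oStP ends o a₁ b WO (restr A z w)) : ℤ) : R) *
          ((weightH g (sortedB ends a₁ a₂ a₃ b WB (restr B z x) (restr B z y) (restr B z w)).1
            (sortedB ends a₁ a₂ a₃ b WB (restr B z x) (restr B z y) (restr B z w)).2.1
            (sortedB ends a₁ a₂ a₃ b WB (restr B z x) (restr B z y) (restr B z w)).2.2 : ℕ) : R)) := by
      funext x y w
      simp only [sideKernel, hΦc, certΦ, combH_eq_gensum]
      push_cast
      refine Finset.sum_congr rfl fun g _ => ?_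
      ring
    rw [hsum, typedCount_finsum]
    refine Finset.sum_nonneg fun g _ => ?_
    have hfac := typedCount_mul_of_disjoint (R := R) A B hAB z τ
      (fun x y w => ((genH g.1 g.2.1 g.2.2 (PocketAB.oStP ends o a₁ b WO x)
        (PocketAB.oStP ends o a₁ b WO y) (PocketAB.oStP ends o a₁ b WO w) : ℤ) : R))
      (fun x y w => ((weightH g (sortedB ends a₁ a₂ a₃ b WB x y w).1
        (sortedB ends a₁ a₂ a₃ b WB x y w).2.1 (sortedB ends a₁ a₂ a₃ b WB x y w).2.2 : ℕ) : R))
    rw [hF] at hfac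
    rw [hfac]
    refine mul_nonneg (typedCount_genH_nonneg WO A z τ hτA g) ?_
    exact typedCount_nonneg_of_nonneg _ _ _ fun x y w => Nat.cast_nonneg _
  -- assemble
  have h36' : (0 : R) ≤ 36 * typedCount F z τ (sideKernel A B z (sideΦH ends o a₁ a₂ a₃ b WO WB)) := by
    rw [h36, hsplit]
    exact add_nonneg hcert hrem
  exact nonneg_of_mul_nonneg_right (by simpa [mul_comm] using h36') (by norm_num : (0 : R) < 36)

variable (ends o a₁ a₂ a₃ b)

/-- **The class of the typed graph `(V, F)`**: the doors `a₁, b` separate `o` from `{a₂, a₃}`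
(`o`'s pocket hangs on the root `a₁` and the mark `b`). -/
def HasPocketA1B (F : Finset E) : Prop :=
  ∃ WO WB : Set V, SplitH ends o a₁ a₂ a₃ b WO WB F (fun _ => false)

/-- **Row 2′TRI on `HasPocketA1B` at `z ≡ false`** — a nonnegativity conjunct for the residual
domain (types in `{1, 2}`). -/
theorem typedCount_nonneg_of_hasPocketA1B (F : Finset E) (τ : E → ℕ)
    (hτ : ∀ e ∈ F, τ e = 1 ∨ τ e = 2) (h : HasPocketA1B ends o a₁ a₂ a₃ b F) :
    0 ≤ typedCount F (fun _ => false) τ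
      (K3 ends o a₁ a₂ a₃ b : Config E → Config E → Config E → R) := by
  obtain ⟨WO, WB, hs⟩ := h
  exact typedCount_nonneg_of_splitH F _ τ hτ hs

/-- **The mirror class** (the doors `a₂, b` separate `o` from `{a₁, a₃}`), by the root symmetry. -/
theorem typedCount_nonneg_of_hasPocketA1B_mirror (F : Finset E) (τ : E → ℕ)
    (hτ : ∀ e ∈ F, τ e = 1 ∨ τ e = 2) (h : HasPocketA1B ends o a₂ a₁ a₃ b F) :
    0 ≤ typedCount F (fun _ => false) τ
      (K3 ends o a₁ a₂ a₃ b : Config E → Config E → Config E → R) := by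
  rw [← SwapRoots.typedCount_swap_roots]
  exact typedCount_nonneg_of_hasPocketA1B ends o a₂ a₁ a₃ b F τ hτ h

end Main

end PocketA1B

end CovForm

end Summit.Ventures.PercRepro2
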